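import Mathlib
import Literature.Computability.Complexity.CliqueTestGraphs
import Summits.PneNP.PneNP.Theorems.ConvexRankGatesConvexGateBlindJuntaBlind

/-!
# PneNP / ConvexRankGates — `ConvexGateBlind`: stabiliser-invariant (Yannakakis-symmetric) LP certificates are ε-exactly blind

Helpers (`--supports stmt-PneNP-10680`), the symmetric form of `…JuntaBlind.lean`. Yannakakis' argument for SYMMETRIC
extended formulations (Yannakakis 1991, Claim 2; Dixon–Mortimer Thm 5.2B) delivers, for every term of a `Sym(m)`-symmetric
non-negative factorisation of size `< C(m, t+1)` (`t < m/4`), a set `W_l` of at most `t` vertices such that the row factor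
`V_l` is invariant under every permutation of the vertices fixing `W_l` pointwise. THIS FILE proves that such factors are
juntas on `(K+1)`-sets (`eq_of_stabiliserInvariant`: two `(K+1)`-sets with the same trace on `W` are joined by a chain of
transpositions of vertices outside `W`) and hence (`cdist_colorVec_not_stabInvariantRep`, registered stub
`stabiliser_blind`) that for a balanced colouring column, `2 ≤ K`, `K + 1 ≤ n`, `2t ≤ K` and EVERY `ε > 0` there is no
identity `cdist Q (colorVec h) - ε = ∑_l V_l(Q)` on the `(K+1)`-sets with `V_l ≥ 0` each invariant under the pointwise
stabiliser of some `W_l`, `#W_l ≤ t` — whatever the number of terms. Combined with the group-theoretic lemma (not formalised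
here) this is the statement "symmetric monotone LPs separating `k`-cliques from complete `(k-1)`-partite graphs in the exact
sense of the crux have size `≥ C(m, ⌊(k-1)/2⌋ + 1)`" (item evidence ANALYSIS-seat2-s11.md §4). [new]
-/

namespace Summit.PneNP.PneNP.Theorems

open Finset Literature.Computability.Complexity
open Summit.PneNP.PneNP.Cruxes.ConvexGateBlind.StrictRankConicCover (cdist)

noncomputable section

variable {m : ℕ}

/-! ## Transpositions outside `W` act transitively on the sets with a given trace on `W` -/

/-- The image of `Q` under the transposition `(a b)` with `a ∈ Q`, `b ∉ Q` is `Q - a + b`. [folklore] -/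
theorem map_swap_eq_insert_erase {Q : Finset (Fin m)} {a b : Fin m} (ha : a ∈ Q) (hb : b ∉ Q) :
    Q.map (Equiv.swap a b).toEmbedding = insert b (Q.erase a) := by
  classical
  ext x
  simp only [mem_map_equiv, Equiv.symm_swap, mem_insert, mem_erase]
  constructor
  · intro hx
    by_cases hxb : x = b
    · exact Or.inl hxb
    · right
      have hxa : x ≠ a := by
        rintro rfl
        rw [Equiv.swap_apply_left] at hx
        exact hb hx
      rw [Equiv.swap_apply_of_ne_of_ne hxa hxb] at hx
      exact ⟨hxa, hx⟩
  · rintro (rfl | ⟨hxa, hxQ⟩)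
    · rw [Equiv.swap_apply_right]; exact ha
    · have hxb : x ≠ b := fun hxb => hb (hxb ▸ hxQ)
      rw [Equiv.swap_apply_of_ne_of_ne hxa hxb]; exact hxQ

/-- **Stabiliser-invariant functions are juntas.** If `V` is invariant (on `c`-sets) under every permutation fixing `W`
pointwise, then `V Q = V Q'` for all `c`-sets `Q, Q'` with the same trace on `W`. Proof: induction on `#(Q ∖ Q')`, one
transposition of two vertices outside `W` at a time. -/
theorem eq_of_stabiliserInvariant (V : Finset (Fin m) → ℝ) (W : Finset (Fin m)) {c : ℕ}
    (hV : ∀ σ : Equiv.Perm (Fin m), (∀ w ∈ W, σ w = w) → ∀ Q : Finset (Fin m), Q.card = c →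
      V (Q.map σ.toEmbedding) = V Q) :
    ∀ (d : ℕ) (Q Q' : Finset (Fin m)), (Q \ Q').card ≤ d → Q.card = c → Q'.card = c → Q ∩ W = Q' ∩ W → V Q = V Q' := by
  classical
  intro d
  induction d with
  | zero =>
    intro Q Q' hd hQ hQ' _
    have hsub : Q ⊆ Q' := by
      have : Q \ Q' = ∅ := card_eq_zero.1 (Nat.le_zero.1 hd)
      exact sdiff_eq_empty_iff_subset.1 this
    rw [eq_of_subset_of_card_le hsub (by rw [hQ, hQ'])]
  | succ d ih =>
    intro Q Q' hd hQ hQ' hW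
    by_cases hzero : (Q \ Q').card = 0
    · exact ih Q Q' (by omega) hQ hQ' hW
    · -- pick `a ∈ Q ∖ Q'` and `b ∈ Q' ∖ Q`; both lie outside `W`
      obtain ⟨a, ha⟩ : (Q \ Q').Nonempty := nonempty_iff_ne_empty.2 (fun h0 => hzero (by rw [h0, card_empty]))
      have hcard' : (Q' \ Q).card = (Q \ Q').card := by
        have h1 := card_sdiff_add_card_inter Q Q'
        have h2 := card_sdiff_add_card_inter Q' Q
        rw [inter_comm] at h2
        omega
      obtain ⟨b, hb⟩ : (Q' \ Q).Nonempty := by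
        rw [← card_pos, hcard']; exact Nat.pos_of_ne_zero hzero
      rw [mem_sdiff] at ha hb
      have haW : a ∉ W := fun haW => ha.2 (mem_of_mem_inter_left (show a ∈ Q' ∩ W from hW ▸ mem_inter.2 ⟨ha.1, haW⟩))
      have hbW : b ∉ W := fun hbW => hb.2 (mem_of_mem_inter_left (show b ∈ Q ∩ W from hW.symm ▸ mem_inter.2 ⟨hb.1, hbW⟩))
      -- transpose `a` and `b`
      set Q₁ : Finset (Fin m) := insert b (Q.erase a) with hQ₁
      have hswap : V Q₁ = V Q := by
        rw [hQ₁, ← map_swap_eq_insert_erase ha.1 hb.2]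
        refine hV (Equiv.swap a b) (fun w hw => ?_) Q hQ
        exact Equiv.swap_apply_of_ne_of_ne (fun h => haW (h ▸ hw)) (fun h => hbW (h ▸ hw))
      have hQ₁card : Q₁.card = c := by
        rw [hQ₁, card_insert_of_notMem (fun h => hb.2 (mem_of_mem_erase h)), card_erase_of_mem ha.1, hQ]
        have : 0 < c := by rw [← hQ]; exact card_pos.2 ⟨a, ha.1⟩
        omega
      have hQ₁W : Q₁ ∩ W = Q' ∩ W := by
        rw [← hW, hQ₁]
        ext x
        simp only [mem_inter, mem_insert, mem_erase]
        constructor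
        · rintro ⟨rfl | ⟨_, hxQ⟩, hxW⟩
          · exact (hbW hxW).elim
          · exact ⟨hxQ, hxW⟩
        · rintro ⟨hxQ, hxW⟩
          exact ⟨Or.inr ⟨fun h => haW (h ▸ hxW), hxQ⟩, hxW⟩
      have hQ₁diff : (Q₁ \ Q').card ≤ d := by
        have hsub : Q₁ \ Q' ⊆ (Q \ Q').erase a := by
          intro x hx
          rw [mem_sdiff, hQ₁, mem_insert, mem_erase] at hx
          rcases hx with ⟨rfl | ⟨hxa, hxQ⟩, hxQ'⟩
          · exact (hxQ' hb.1).elim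
          · exact mem_erase.2 ⟨hxa, mem_sdiff.2 ⟨hxQ, hxQ'⟩⟩
        have := card_le_card hsub
        rw [card_erase_of_mem (mem_sdiff.2 ha)] at this
        omega
      rw [← hswap]
      exact ih Q₁ Q' hQ₁diff hQ₁card hQ' hQ₁W

/-! ## The theorem -/

/-- **Stabiliser-invariant non-negative certificates are ε-exactly blind on colouring columns.** For a balanced colouring
`h` (`K ≥ 2` classes of size `n ≥ K + 1`), `2t ≤ K`, and every `ε > 0`: there is no identity
`cdist Q (colorVec h) - ε = ∑_l V_l(Q)` on the `(K+1)`-sets with `V_l ≥ 0` and each `V_l` invariant (on `(K+1)`-sets) under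
every vertex permutation fixing some `W_l` with `#W_l ≤ t` pointwise — whatever the number of terms. (Each `V_l` is then a
junta on `W_l`; apply `cdist_colorVec_not_juntaRep`.) [new] -/
theorem cdist_colorVec_not_stabInvariantRep {K : ℕ} (h : Fin m → Fin K) {n t : ℕ} (hn : ∀ c, (cls h c).card = n)
    (hK : 2 ≤ K) (hKn : K + 1 ≤ n) (ht : 2 * t ≤ K) {ε : ℝ} (hε : 0 < ε) {ι : Type*} [Fintype ι]
    (W : ι → Finset (Fin m)) (hW : ∀ l, (W l).card ≤ t) (V : ι → Finset (Fin m) → ℝ)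
    (hV0 : ∀ l Q, Q.card = K + 1 → 0 ≤ V l Q)
    (hV : ∀ l (σ : Equiv.Perm (Fin m)), (∀ w ∈ W l, σ w = w) → ∀ Q : Finset (Fin m), Q.card = K + 1 →
      V l (Q.map σ.toEmbedding) = V l Q) :
    ¬ ∀ Q : Finset (Fin m), Q.card = K + 1 → cdist Q (colorVec h) - ε = ∑ l, V l Q := by
  classical
  intro hrep
  -- the junta values
  let F : ι → Finset (Fin m) → ℝ := fun l P =>
    if hP : ∃ Q : Finset (Fin m), Q.card = K + 1 ∧ Q ∩ W l = P then V l hP.choose else 0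
  have hF : ∀ l (Q : Finset (Fin m)), Q.card = K + 1 → V l Q = F l (Q ∩ W l) := by
    intro l Q hQ
    have hP : ∃ Q' : Finset (Fin m), Q'.card = K + 1 ∧ Q' ∩ W l = Q ∩ W l := ⟨Q, hQ, rfl⟩
    simp only [F, dif_pos hP]
    exact eq_of_stabiliserInvariant (V l) (W l) (hV l) _ Q hP.choose le_rfl hQ hP.choose_spec.1
      hP.choose_spec.2.symm
  refine cdist_colorVec_not_juntaRep h hn hK hKn ht hε W F hW ?_ ?_
  · intro l P
    simp only [F]
    split_ifs with hP
    · exact hV0 l _ hP.choose_spec.1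
    · exact le_refl _
  · intro Q hQ
    rw [hrep Q hQ]
    exact Finset.sum_congr rfl fun l _ => hF l Q hQ

/-- **Registered helper stub (stabiliser-invariant certificates are blind).** Restatement of
`cdist_colorVec_not_stabInvariantRep` with all parameters explicit. -/
theorem stabiliser_blind : ∀ {m K n t : ℕ} (h : Fin m → Fin K), (∀ c, (cls h c).card = n) → 2 ≤ K → K + 1 ≤ n → 2 * t ≤ K → ∀ (ε : ℝ), 0 < ε → ∀ {ι : Type} [Fintype ι] (W : ι → Finset (Fin m)) (V : ι → Finset (Fin m) → ℝ), (∀ l, (W l).card ≤ t) → (∀ l Q, Q.card = K + 1 → 0 ≤ V l Q) → (∀ l (σ : Equiv.Perm (Fin m)), (∀ w ∈ W l, σ w = w) → ∀ Q : Finset (Fin m), Q.card = K + 1 → V l (Q.map σ.toEmbedding) = V l Q) → ¬ ∀ Q : Finset (Fin m), Q.card = K + 1 → cdist Q (colorVec h) - ε = ∑ l, V l Q := by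
  intro m K n t h hn hK hKn ht ε hε ι _ W V hW hV0 hV
  exact cdist_colorVec_not_stabInvariantRep h hn hK hKn ht hε W hW V hV0 hV

end

end Summit.PneNP.PneNP.Theorems
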